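import Literature.NumberTheory.LFunctions.DirichletLOneOdd
import Literature.NumberTheory.QuadraticFields.ChowlaCentralFactorialProofs
import Literature.NumberTheory.QuadraticFields.JacobiCharacterPrimitiveProofs
import Literature.NumberTheory.QuadraticFields.FundamentalDiscriminant
import Mathlib.NumberTheory.NumberField.ClassNumber
import HarnessLib

/-!
# Chowla–Selberg at `D = −15`, III: the two genus `L`-values `L(1, χ₋₃) = π/(3√3)` and
# `L(1, χ₅) = (2/√5) log ((1+√5)/2)`

Topic `NumberTheory/QuadraticFields`, namespace
`Literature.NumberTheory.QuadraticFields.ChowlaSelbergFifteen` (sequel of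
`ChowlaSelbergFifteenGenus.lean`, whose `C₁ − C₂ = 2L(1,χ₋₃)L(1,χ₅)` these values make explicit).
Everything here is PROVED (theorems only; no definitions, no named facts).

* `LFunction_jacobiChar_three_one` — **`L(1, χ₋₃) = π/(3√3)`**, `χ₋₃ = (·/3)` (`jacobiChar 3`):
  the tree's odd-character evaluation `τ(χ) L(1, χ̄) = −(πi/p) Σ_a χ(a) a`
  (`DirichletLOneOdd.gaussSum_mul_LFunction_inv_one`, Lang, *Cyclotomic Fields*, Ch. 3 Thm. 2.2)
  with `p = 3`, `Σ_a χ(a)a = −1`, and the Gauss sum `τ(χ₋₃) = e^{2πi/3} − e^{4πi/3} = i√3`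
  (`gaussSum_jacobiChar_three`);
* `LFunction_jacobiChar_five_one` — **`L(1, χ₅) = 2 log((1+√5)/2)/√5`**, `χ₅ = (·/5)`
  (`jacobiChar 5`): Dirichlet's class number formula for `ℚ(√5)` in the tree's form
  `L(1, χ_p) = 2 h log ε₀/√p` (`ChowlaProof.LFunction_one_eq_of_minimal`, with the least solution
  `(t, u) = (1, 1)` of `t² + 4 = 5u²`, `ε₀ = (1+√5)/2`), and `h(ℚ(√5)) = 1` by Minkowski's bound
  (Mathlib `isPrincipalIdealRing_of_abs_discr_lt`: `5 < 16`).

## References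

* [Lang1990] S. Lang, *Cyclotomic Fields I and II*, GTM 121 (1990), Ch. 3 §2, Thm. 2.2.
* [UrbanowiczWilliams2000] J. Urbanowicz, K. S. Williams, *Congruences for L-functions* (2000),
  Ch. I §8.2 (18) (`L(1, χ_p) = 2h log ε/√p`).
* H. Davenport, *Multiplicative Number Theory*, Ch. 6 (`L(1, χ)` for real characters; the values
  for conductors `3` and `5`).
-/

noncomputable section

open Complex Filter Topology Module NumberField Finset
open Literature.NumberTheory.QuadraticFields.Quadratic
open scoped NumberTheorySymbols Real

namespace Literature.NumberTheory.QuadraticFields.ChowlaSelbergFifteen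

/-! ### `L(1, χ₋₃) = π/(3√3)` -/

/-- `χ₋₃ = (·/3)` is odd. [folklore] -/
theorem jacobiChar_three_odd : (jacobiChar 3).Odd :=
  jacobiChar_neg_one_of_mod_four_eq_three (by norm_num)

/-- `χ₋₃(2) = −1`. [folklore] -/
theorem jacobiChar_three_two : jacobiChar 3 (2 : ZMod 3) = -1 := by
  have hZ : J(((2 : ℕ) : ℤ) | 3) = -1 := by norm_num
  rw [show (2 : ZMod 3) = ((2 : ℕ) : ZMod 3) by rfl, jacobiChar_natCast, hZ]
  push_cast
  ring

/-- The elements of `ZMod 3`. [folklore] -/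
theorem univ_zmod_three : (univ : Finset (ZMod 3)) = {0, 1, 2} := by decide

/-- `Σ_{a mod 3} χ₋₃(a) a = −1` (`= 3 B_{1,χ}`, i.e. `B_{1,χ₋₃} = −1/3`). [folklore] -/
theorem sum_jacobiChar_three_mul_val : ∑ a : ZMod 3, jacobiChar 3 a * (a.val : ℂ) = -1 := by
  rw [univ_zmod_three, sum_insert (by decide), sum_insert (by decide), sum_singleton,
    MulChar.map_zero, map_one, jacobiChar_three_two]
  rw [show (1 : ZMod 3).val = 1 by rfl, show (2 : ZMod 3).val = 2 by rfl]
  push_cast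
  ring

/-- `Σ_{a mod 3} χ₋₃(a) sin(2πa/3) = √3` (`sin(2π/3) = √3/2 = −sin(4π/3)`). [folklore] -/
theorem sum_jacobiChar_three_mul_sin :
    ∑ a : ZMod 3, jacobiChar 3 a * ((Real.sin (2 * Real.pi * (1 : ℕ) * a.val / (3 : ℕ)) : ℝ) : ℂ) =
      (Real.sqrt 3 : ℂ) := by
  rw [univ_zmod_three, sum_insert (by decide), sum_insert (by decide), sum_singleton,
    MulChar.map_zero, map_one, jacobiChar_three_two]
  rw [show (1 : ZMod 3).val = 1 by rfl, show (2 : ZMod 3).val = 2 by rfl]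
  have h1 : Real.sin (2 * Real.pi * (1 : ℕ) * (1 : ℕ) / (3 : ℕ)) = Real.sqrt 3 / 2 := by
    rw [show 2 * Real.pi * (1 : ℕ) * (1 : ℕ) / (3 : ℕ) = Real.pi - Real.pi / 3 by push_cast; ring,
      Real.sin_pi_sub, Real.sin_pi_div_three]
  have h2 : Real.sin (2 * Real.pi * (1 : ℕ) * (2 : ℕ) / (3 : ℕ)) = -(Real.sqrt 3 / 2) := by
    rw [show 2 * Real.pi * (1 : ℕ) * (2 : ℕ) / (3 : ℕ) = Real.pi / 3 + Real.pi by push_cast; ring,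
      Real.sin_add_pi, Real.sin_pi_div_three]
  rw [h1, h2]
  push_cast
  ring

/-- **The Gauss sum of `χ₋₃`: `τ(χ₋₃) = Σ_a χ₋₃(a) e^{2πia/3} = i√3`.** [cite: Lang1990, Ch. 3 §2 Thm. 2.2] -/
theorem gaussSum_jacobiChar_three : gaussSum (jacobiChar 3) ZMod.stdAddChar = I * Real.sqrt 3 := by
  haveI : Fact (Nat.Prime 3) := ⟨Nat.prime_three⟩
  have h := Literature.NumberTheory.LFunctions.DirichletLOneOdd.gaussSum_mulShift_eq_sum_exp
    (p := 3) (jacobiChar 3) 1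
  rw [Nat.cast_one, AddChar.mulShift_one] at h
  rw [h, Literature.NumberTheory.LFunctions.DirichletLOneOdd.sum_mul_exp_eq_I_mul_sum_sin
    jacobiChar_three_odd 1, sum_jacobiChar_three_mul_sin]

/-- **`L(1, χ₋₃) = π/(3√3)`** (`τ(χ)L(1,χ) = −(πi/3)·(−1)`, `τ = i√3`). [cite: Lang1990, Ch. 3 §2 Thm. 2.2] -/
theorem LFunction_jacobiChar_three_one :
    (jacobiChar 3).LFunction 1 = ((Real.pi / (3 * Real.sqrt 3) : ℝ) : ℂ) := by
  haveI : Fact (Nat.Prime 3) := ⟨Nat.prime_three⟩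
  have h := Literature.NumberTheory.LFunctions.DirichletLOneOdd.gaussSum_mul_LFunction_inv_one
    (p := 3) jacobiChar_three_odd
  rw [gaussSum_jacobiChar_three, sum_jacobiChar_three_mul_val,
    (isQuadratic_jacobiChar (q := 3)).inv] at h
  have hs : (Real.sqrt 3 : ℂ) ≠ 0 := ofReal_ne_zero.mpr (Real.sqrt_ne_zero'.mpr (by norm_num))
  have hI : (I * Real.sqrt 3 : ℂ) ≠ 0 := mul_ne_zero I_ne_zero hs
  have key : (I * Real.sqrt 3) * (jacobiChar 3).LFunction 1 = Real.pi * I / 3 := by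
    rw [h]; push_cast; ring
  have hv : (I * Real.sqrt 3) * (((Real.pi / (3 * Real.sqrt 3) : ℝ)) : ℂ) = Real.pi * I / 3 := by
    push_cast
    field_simp
  exact mul_left_cancel₀ hI (key.trans hv.symm)

/-! ### `L(1, χ₅) = (2/√5) log((1+√5)/2)` -/

/-- `5` is a fundamental discriminant. [folklore] -/
theorem isFundamental_five :
    ((5 : ℤ) % 4 = 1 ∧ Squarefree (5 : ℤ) ∧ (5 : ℤ) ≠ 1) ∨
      (4 ∣ (5 : ℤ) ∧ ((5 : ℤ) / 4 % 4 = 2 ∨ (5 : ℤ) / 4 % 4 = 3) ∧ Squarefree ((5 : ℤ) / 4)) := by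
  refine Or.inl ⟨by norm_num, ?_, by norm_num⟩
  rw [← Int.squarefree_natAbs]
  exact Nat.prime_five.squarefree

section Field

variable {K : Type*} [Field K] [NumberField K]

/-- **`h(ℚ(√5)) = 1`** by Minkowski's bound: `|d_K| = 5 < (2 · 2²/2!)² = 16` (no complex places).
[folklore] -/
theorem classNumber_eq_one_of_discr_five (h2 : finrank ℚ K = 2) (hd : NumberField.discr K = 5) :
    NumberField.classNumber K = 1 := by
  obtain ⟨-, hc0⟩ := nrRealPlaces_eq_two_and_nrComplexPlaces_eq_zero h2 (by rw [hd]; norm_num)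
  rw [NumberField.classNumber_eq_one_iff]
  apply RingOfIntegers.isPrincipalIdealRing_of_abs_discr_lt
  rw [hc0, h2, hd]
  norm_num [Nat.factorial]

/-- **`L(1, χ₅) = 2 log((1+√5)/2)/√5`** for a quadratic field of discriminant `5` in the role of
`ℚ(√5)` (class number formula, `h = 1`, `ε₀ = (1+√5)/2`). [cite: UrbanowiczWilliams2000, Ch. I §8.2 (18)] -/
theorem LFunction_jacobiChar_five_one_of_field (h2 : finrank ℚ K = 2) (hd : NumberField.discr K = 5) :
    (jacobiChar 5).LFunction 1 = ((2 * Real.log ((1 + Real.sqrt 5) / 2) / Real.sqrt 5 : ℝ) : ℂ) := by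
  haveI : Fact (Nat.Prime 5) := ⟨Nat.prime_five⟩
  have hmin : ∀ t' u' : ℕ, t' ^ 2 + 4 = 5 * u' ^ 2 → 0 < u' → 1 ≤ t' := by
    intro t' u' h hu'
    rcases Nat.eq_zero_or_pos t' with rfl | hpos
    · exfalso
      have h5 : (5 : ℕ) ∣ 4 := ⟨u' ^ 2, by simpa using h⟩
      norm_num at h5
    · exact hpos
  have h := ChowlaProof.LFunction_one_eq_of_minimal (p := 5) (K := K) (by norm_num) h2
    (by rw [hd]; rfl) (t := 1) (u := 1) (by norm_num) one_pos hmin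
  rw [h, classNumber_eq_one_of_discr_five h2 hd]
  push_cast
  ring_nf

end Field

/-- **`L(1, χ₅) = 2 log((1+√5)/2)/√5`**, `χ₅ = (·/5)`. [cite: UrbanowiczWilliams2000, Ch. I §8.2 (18)] -/
theorem LFunction_jacobiChar_five_one :
    (jacobiChar 5).LFunction 1 = ((2 * Real.log ((1 + Real.sqrt 5) / 2) / Real.sqrt 5 : ℝ) : ℂ) := by
  obtain ⟨K, _, _, h2, hd⟩ := exists_numberField_discr_eq isFundamental_five
  exact LFunction_jacobiChar_five_one_of_field h2 hd

/-- **`2 L(1, χ₋₃) L(1, χ₅) = (4π/(3√15)) log((1+√5)/2)`** — the value of `C₁ − C₂`.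
[folklore] -/
theorem two_mul_LFunction_three_mul_five :
    2 * ((jacobiChar 3).LFunction 1 * (jacobiChar 5).LFunction 1) =
      ((4 * Real.pi / (3 * Real.sqrt 15) * Real.log ((1 + Real.sqrt 5) / 2) : ℝ) : ℂ) := by
  rw [LFunction_jacobiChar_three_one, LFunction_jacobiChar_five_one]
  have h15 : Real.sqrt 15 = Real.sqrt 3 * Real.sqrt 5 := by
    rw [← Real.sqrt_mul (by norm_num)]; norm_num
  have h3 : Real.sqrt 3 ≠ 0 := Real.sqrt_ne_zero'.mpr (by norm_num)
  have h5 : Real.sqrt 5 ≠ 0 := Real.sqrt_ne_zero'.mpr (by norm_num)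
  rw [h15]
  push_cast
  field_simp
  ring

end Literature.NumberTheory.QuadraticFields.ChowlaSelbergFifteen
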